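import Summits.QuantumFields.YangMills.Theorems.BalabanUVNodesN15KingModelAnalyticBlockCovWindow
import Literature.Analysis.InnerProduct.KroneckerOperatorNorm
import HarnessLib

/-!
# BalabanUVNodes ∕ N15 — THE KING-MODEL RUNG (PART Ϫ-c): THE CONTINUED BLOCK-FIELD COVARIANCE IS BOUNDED IN OPERATOR NORM BY `a⁻¹ + 4e∕m²` THROUGHOUT THE POLYDISC — the `ℓ² → ℓ²` norms of
# Bałaban's continued block maps near a unitary field (`‖Q♯_K(V)‖ ≤ √(L^{d+1})(1+ε)^D`, `‖Q(U)‖ ≤ (1+ε)^D∕√(L^{d+1})`: the `η`-powers CANCEL in the sandwich), hence ★★★★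
# `‖C(U,U⁻¹) − a⁻¹1‖ ≤ 4e∕m²` and `‖C(U,U⁻¹)‖ ≤ a⁻¹ + 4e∕m²` at the mass radius around every unitary background; at a unitary field ★★★ `‖(Δ_eff(U))⁻¹‖ ≤ a⁻¹ + m⁻²` in operator norm
# (the complex twin ∕ operator form of PART Ϥ-k's form sandwich `a⁻¹ ≤ (Δ_eff(U))⁻¹ ≤ a⁻¹ + m⁻²`)
# (Track A, DAG node N15 = NE2; FAN-OUT v1.1 §N15 s3 «KING-MODEL RUNG … + what the curved case adds»; count-neutral)

HONEST FRAMING.  Count-neutral (cell `pub-ymgap`, seat `pub-ymgap-dag-n15-e` g52; `--supports stmt-QuantumFields-27247 --as helper` = K3ᴬ, KEY MAP v3).  King's one-level comparison model,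
massive fine covariance, any fibre; operator norms are the `ℓ²(T×n) → ℓ²` norms (Mathlib's `Matrix.Norms.L2Operator`).  The constant `4e∕m²` comes from PART Ϩ-g's `‖B⁻¹‖ ≤ 4∕m²` and the
transport budget `(1+2ε)^{2D} ≤ e` at the radius; at `ε = 0` it is `m⁻²`.  NOT Bałaban's multi-level objects; NOT a node discharge (N15 of record untouched); nothing continuum ∕ ℝ⁴ ∕ OS ∕ Clay.

THE RESULTS (`T` of depth `≤ D`, unitary `U₀`, `0 ≤ ε`):
* §1 `fib_cxQadj_mulVec_site`, `cxKingQadj_mulVec`, ★ `fib_cxKingQadj_mulVec_site` (THE CONTINUED `η`-ADJOINT ACTS FIBREWISE: `(Q♯_K(V)g)(x_j(y)) = V(Γ_{x_j,y})·g(y)` — one term per fine site), `norm_fib_cxKingQadj_mulVec_site_le`,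
  ★★ **`l2_opNorm_cxKingQadj_le_of_near`** (`‖V_b − U₀_bᴴ‖ ≤ ε` ⟹ `‖Q♯_K(V)‖ ≤ √(L^{d+1})·(1+ε)^D`), ★★ **`l2_opNorm_covQ_le_of_near`** (`‖U_b − U₀_b‖ ≤ ε` ⟹ `‖Q(U)‖ ≤ (1+ε)^D∕√(L^{d+1})`, by
  duality `Q(U)ᴴ = L^{−(d+1)}Q♯_K(Uᴴ)`), ★★★ **`l2_opNorm_zero_sandwich_le_of_near`** (`‖Q(U)·S·Q♯_K(V)‖ ≤ (1+ε)^D(1+ε′)^D·‖S‖` for ANY fine operator `S` — the `η`-powers cancel).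
* §2 AT THE MASS RADIUS (print's slice, King's scaling, comb depth, `a, m² > 0`, `Lε ≤ s₀(m²,a,d)`): `transport_budget_at_massRadius` (`(1+ε)^D(1+2ε)^D ≤ e`),
  ★★★★ **`l2_opNorm_cxBlockCov_sub_noise_at_massRadius_le`** (`‖C(U,U⁻¹) − a⁻¹1‖ ≤ 4e∕m²`), ★★★★ **`l2_opNorm_cxBlockCov_at_massRadius_le`** (`‖C(U,U⁻¹)‖ ≤ a⁻¹ + 4e∕m²` — NE2's UNIT LAYER IS
  BOUNDED IN OPERATOR NORM, `η`-UNIFORMLY, THROUGHOUT THE COMPLEX POLYDISC AROUND EVERY UNITARY BACKGROUND).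
* §3 AT A UNITARY FIELD (every unitary `U`, no window): `l2_opNorm_covLapF_inv_le` (`‖(−cΔ_U+m²)⁻¹‖ ≤ m⁻²`, PART Ͱ-f in operator norm), ★★★ **`l2_opNorm_effLapU_inv_sub_noise_le`** (`‖(Δ_eff(U))⁻¹ − a⁻¹1‖ ≤ m⁻²`),
  ★★★ **`l2_opNorm_effLapU_inv_le`** (`‖(Δ_eff(U))⁻¹‖ ≤ a⁻¹ + m⁻²` — PART Ϥ-k's sandwich in operator norm, every curved background).
PRIOR TREE ART (by name): Ϫ-a (`cxBlockCov`, `cxBlockCov_zero_sandwich`, `conjTranspose_covQ_eq`, `cxBlockCov_inv_of_unitary`, `cxFullOp_zero_inv_eq_covLapF`), Ϫ-b (`l2_opNorm_cxFullOp_zero_inv_at_massRadius_le`,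
`sliceRadius_anti`), Ϩ-a (`cxQadj_apply_site`), Ϩ-d (`norm_treeHol_le_pow_of_near`, `norm_treeHolRev_le_pow_of_near`), Ϩ-f (`slice_near_bwd`), Ϩ-g (`sliceRadius_le`, `tau_slice_le`), Ϩ-l (`cxKingQadj`),
Ͱ-f (`norm_toLp_inv_mulVec_le`), Literature `KroneckerOperatorNorm.l2_opNorm_le_of_forall_norm_mulVec_le`, Mathlib (`Matrix.l2_opNorm_mulVec`, `Matrix.l2_opNorm_mul`, `Matrix.l2_opNorm_conjTranspose`).
Dedup (rg at filing): basename 0 files; needles `l2_opNorm_cxKingQadj|l2_opNorm_covQ_le|l2_opNorm_cxBlockCov|l2_opNorm_effLapU_inv` 0 tree files.  Locators: [King1986] (2.13)–(2.14) p.653, (4.34) p.674,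
(4.45) p.675; [Balaban1985BackgroundPropagators] (3.19) p.393, (3.39) p.397, Thm 3.4 p.400.  0 `sorry`, 0 `def`.
-/

noncomputable section
open scoped BigOperators ComplexConjugate ComplexOrder Matrix.Norms.L2Operator
open Finset Matrix WithLp

namespace Summit.QuantumFields.YangMills.BalabanUVNodes.N15KingModelRung.Analytic

open Literature.MathematicalPhysics.QuantumFieldTheory.Balaban1983to89.B5Prop11Plancherel (Tor fine)
open Literature.MathematicalPhysics.QuantumFieldTheory.King1986.Torus (site blockOf blockOf_site blockEquiv blockEquiv_apply exists_eq_site)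
open Literature.Analysis.InnerProduct (l2_opNorm_le_of_forall_norm_mulVec_le)
open Summit.QuantumFields.YangMills.BalabanUVNodes.N15KingModelRung.Covariant (covLapF fib fib_apply fib_smul sum_norm_fib_sq norm_toLp_inv_mulVec_le)
open Summit.QuantumFields.YangMills.BalabanUVNodes.N15KingModelRung.CovariantBlock (BlockTree treeHol covQ kingQadjU fullOpU effLapU)

variable {d : ℕ} {L : ℕ} [NeZero L] (T : BlockTree d L) (M : Fin (d + 1) → ℕ) [hM : ∀ μ, NeZero (M μ)]
variable {𝕜 : Type*} [RCLike 𝕜] {n : Type*} [Fintype n] [DecidableEq n]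

/-! ## §1 Operator norms of the continued block maps near a unitary field -/

section BlockMaps

/-- THE FIBRES OF `Q♯(V)g` ON A BLOCK: `(Q♯(V)g)(x_j(y)) = L^{−(d+1)}·V(Γ_{x_j,y})·g(y)`. [cite: Balaban1985BackgroundPropagators, (3.19) p.393, §3.B p.399 l.37–40] -/
theorem fib_cxQadj_mulVec_site (V : Tor (fine L M) × Fin (d + 1) → Matrix n n 𝕜) (g : Tor M × n → 𝕜) (y : Tor M) (j : Fin (d + 1) → Fin L) :
    fib (fine L M) (cxQadj T M V *ᵥ g) (site L M y j) = (toLp 2 ((((((L : ℝ) ^ (d + 1))⁻¹ : ℝ)) : 𝕜) • (treeHolRev M T V y j *ᵥ fun i => g (y, i))) : EuclideanSpace 𝕜 n) := by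
  have hc : ((L : 𝕜) ^ (d + 1))⁻¹ = (((((L : ℝ) ^ (d + 1))⁻¹ : ℝ)) : 𝕜) := by push_cast; ring
  ext k
  rw [fib_apply, PiLp.toLp_apply, Pi.smul_apply, smul_eq_mul, Matrix.mulVec, dotProduct, Fintype.sum_prod_type, Finset.sum_eq_single y]
  · simp only [cxQadj_apply_site, if_true, Matrix.mulVec, dotProduct, Finset.mul_sum]
    refine Finset.sum_congr rfl fun i _ => ?_
    rw [hc]; ring
  · intro b _ hb; exact Finset.sum_eq_zero fun i _ => by rw [cxQadj_apply_site, if_neg (Ne.symm hb), zero_mul]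
  · intro h; exact absurd (Finset.mem_univ y) h

/-- `Q♯_K(V)g = L^{d+1}·Q♯(V)g`. [cite: King1986, (2.13) p.653] -/
theorem cxKingQadj_mulVec (V : Tor (fine L M) × Fin (d + 1) → Matrix n n 𝕜) (g : Tor M × n → 𝕜) : cxKingQadj T M V *ᵥ g = ((L : 𝕜) ^ (d + 1)) • (cxQadj T M V *ᵥ g) := by
  rw [cxKingQadj, Matrix.smul_mulVec]

/-- ★ **THE CONTINUED `η`-ADJOINT ACTS FIBREWISE**: `(Q♯_K(V)g)(x_j(y)) = V(Γ_{x_j,y})·g(y)` — exactly one block point feeds each fine site. [cite: King1986, (2.13) p.653; Balaban1985BackgroundPropagators, (3.19) p.393] -/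
theorem fib_cxKingQadj_mulVec_site (V : Tor (fine L M) × Fin (d + 1) → Matrix n n 𝕜) (g : Tor M × n → 𝕜) (y : Tor M) (j : Fin (d + 1) → Fin L) :
    fib (fine L M) (cxKingQadj T M V *ᵥ g) (site L M y j) = (toLp 2 (treeHolRev M T V y j *ᵥ fun i => g (y, i)) : EuclideanSpace 𝕜 n) := by
  have hL : ((L : 𝕜) ^ (d + 1)) ≠ 0 := pow_ne_zero _ (by exact_mod_cast NeZero.ne L)
  have hc : (((((L : ℝ) ^ (d + 1))⁻¹ : ℝ)) : 𝕜) = ((L : 𝕜) ^ (d + 1))⁻¹ := by push_cast; ring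
  rw [cxKingQadj_mulVec, fib_smul, fib_cxQadj_mulVec_site, ← WithLp.toLp_smul, smul_smul, hc, mul_inv_cancel₀ hL, one_smul]

variable {D : ℕ} (hD : ∀ j, T.depth j ≤ D) {U₀ : Tor (fine L M) × Fin (d + 1) → Matrix n n 𝕜} (hU₀ : ∀ bd, U₀ bd ∈ Matrix.unitaryGroup n 𝕜) {ε : ℝ} (hε0 : 0 ≤ ε)
include hD hU₀ hε0

/-- THE FIBRE SIZE: `‖(Q♯_K(V)g)(x_j(y))‖ ≤ (1+ε)^D·‖g(y)‖` for `V` within `ε` of `U₀ᴴ`. [cite: Balaban1985BackgroundPropagators, (3.19) p.393, §3.B p.399 l.37–40] -/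
theorem norm_fib_cxKingQadj_mulVec_site_le {V : Tor (fine L M) × Fin (d + 1) → Matrix n n 𝕜} (hV : ∀ bd, ‖V bd - (U₀ bd)ᴴ‖ ≤ ε) (g : Tor M × n → 𝕜) (y : Tor M) (j : Fin (d + 1) → Fin L) :
    ‖fib (fine L M) (cxKingQadj T M V *ᵥ g) (site L M y j)‖ ≤ (1 + ε) ^ D * ‖fib M g y‖ := by
  have hr : (1 : ℝ) ≤ 1 + ε := by linarith
  rw [fib_cxKingQadj_mulVec_site]
  have h1 : ‖(toLp 2 (treeHolRev M T V y j *ᵥ fun i => g (y, i)) : EuclideanSpace 𝕜 n)‖ ≤ ‖treeHolRev M T V y j‖ * ‖fib M g y‖ :=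
    Matrix.l2_opNorm_mulVec (treeHolRev M T V y j) (fib M g y)
  exact h1.trans (mul_le_mul_of_nonneg_right ((norm_treeHolRev_le_pow_of_near T M hU₀ hε0 hV y j).trans (pow_le_pow_right₀ hr (hD j))) (norm_nonneg _))

/-- ★★ **THE OPERATOR NORM OF THE CONTINUED `η`-ADJOINT**: `‖Q♯_K(V)‖ ≤ √(L^{d+1})·(1+ε)^D` for `V` within `ε` of `U₀ᴴ` (`L^{d+1}` fine sites per block, each fed once).
[cite: King1986, (2.13) p.653; Balaban1985BackgroundPropagators, (3.19) p.393, (3.39) p.397] -/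
theorem l2_opNorm_cxKingQadj_le_of_near {V : Tor (fine L M) × Fin (d + 1) → Matrix n n 𝕜} (hV : ∀ bd, ‖V bd - (U₀ bd)ᴴ‖ ≤ ε) :
    ‖cxKingQadj T M V‖ ≤ Real.sqrt ((L : ℝ) ^ (d + 1)) * (1 + ε) ^ D := by
  have hL0 : (0 : ℝ) ≤ (L : ℝ) ^ (d + 1) := by positivity
  refine l2_opNorm_le_of_forall_norm_mulVec_le _ (by positivity) fun w => ?_
  set g : Tor M × n → 𝕜 := ofLp w with hg
  have hw : ‖w‖ = ‖(toLp 2 g : EuclideanSpace 𝕜 (Tor M × n))‖ := rfl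
  -- squared bound
  have hsq : ‖(toLp 2 (cxKingQadj T M V *ᵥ g) : EuclideanSpace 𝕜 (Tor (fine L M) × n))‖ ^ 2 ≤ (Real.sqrt ((L : ℝ) ^ (d + 1)) * (1 + ε) ^ D * ‖(toLp 2 g : EuclideanSpace 𝕜 (Tor M × n))‖) ^ 2 := by
    rw [← sum_norm_fib_sq, ← (blockEquiv L M).sum_comp, Fintype.sum_prod_type, mul_pow, mul_pow, Real.sq_sqrt hL0, ← sum_norm_fib_sq M g]
    have hterm : ∀ (y : Tor M) (j : Fin (d + 1) → Fin L), ‖fib (fine L M) (cxKingQadj T M V *ᵥ g) (blockEquiv L M (y, j))‖ ^ 2 ≤ ((1 + ε) ^ D) ^ 2 * ‖fib M g y‖ ^ 2 := fun y j => by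
      rw [blockEquiv_apply, ← mul_pow]
      exact pow_le_pow_left₀ (norm_nonneg _) (norm_fib_cxKingQadj_mulVec_site_le T M hD hU₀ hε0 hV g y j) 2
    calc ∑ y, ∑ j, ‖fib (fine L M) (cxKingQadj T M V *ᵥ g) (blockEquiv L M (y, j))‖ ^ 2 ≤ ∑ y : Tor M, ∑ _j : Fin (d + 1) → Fin L, ((1 + ε) ^ D) ^ 2 * ‖fib M g y‖ ^ 2 :=
          Finset.sum_le_sum fun y _ => Finset.sum_le_sum fun j _ => hterm y j
      _ = (L : ℝ) ^ (d + 1) * ((1 + ε) ^ D) ^ 2 * ∑ y, ‖fib M g y‖ ^ 2 := by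
          rw [Finset.mul_sum]
          refine Finset.sum_congr rfl fun y _ => ?_
          rw [Finset.sum_const, Finset.card_univ, Fintype.card_fun, Fintype.card_fin, Fintype.card_fin, nsmul_eq_mul]
          push_cast; ring
  rw [hw]
  exact (abs_le_of_sq_le_sq' hsq (by positivity)).2

omit [NeZero L] hM hD hU₀ hε0 in
/-- The fibre blocks of `(U − U₀)ᴴ` are as close: `‖U_bᴴ − U₀_bᴴ‖ ≤ ε`. [folklore] -/
theorem near_conjTranspose {U : Tor (fine L M) × Fin (d + 1) → Matrix n n 𝕜} (hU : ∀ bd, ‖U bd - U₀ bd‖ ≤ ε) (bd : Tor (fine L M) × Fin (d + 1)) :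
    ‖(fun bd => (U bd)ᴴ) bd - (U₀ bd)ᴴ‖ ≤ ε := by
  rw [show (fun bd => (U bd)ᴴ) bd - (U₀ bd)ᴴ = (U bd - U₀ bd)ᴴ by rw [conjTranspose_sub], Matrix.l2_opNorm_conjTranspose]
  exact hU bd

/-- ★★ **THE OPERATOR NORM OF THE CONTINUED BLOCK MEAN**: `‖Q(U)‖ ≤ (1+ε)^D∕√(L^{d+1})` for `U` within `ε` of the unitary `U₀` — by duality `Q(U)ᴴ = L^{−(d+1)}Q♯_K(Uᴴ)`.
[cite: Balaban1985BackgroundPropagators, (3.19) p.393, (3.39) p.397; King1986, (2.13) p.653] -/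
theorem l2_opNorm_covQ_le_of_near {U : Tor (fine L M) × Fin (d + 1) → Matrix n n 𝕜} (hU : ∀ bd, ‖U bd - U₀ bd‖ ≤ ε) :
    ‖covQ T M U‖ ≤ (1 + ε) ^ D / Real.sqrt ((L : ℝ) ^ (d + 1)) := by
  have hL0 : (0 : ℝ) < (L : ℝ) ^ (d + 1) := by have : (0 : ℝ) < L := (by exact_mod_cast Nat.pos_of_ne_zero (NeZero.ne L)); positivity
  have hs0 : 0 < Real.sqrt ((L : ℝ) ^ (d + 1)) := Real.sqrt_pos.2 hL0
  have h := l2_opNorm_cxKingQadj_le_of_near T M hD hU₀ hε0 (near_conjTranspose M hU)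
  have hc : ((L : 𝕜) ^ (d + 1))⁻¹ = (((((L : ℝ) ^ (d + 1))⁻¹ : ℝ)) : 𝕜) := by push_cast; ring
  rw [← Matrix.l2_opNorm_conjTranspose, conjTranspose_covQ_eq, hc, norm_smul, RCLike.norm_ofReal, abs_of_pos (inv_pos.2 hL0)]
  calc ((L : ℝ) ^ (d + 1))⁻¹ * ‖cxKingQadj T M fun bd => (U bd)ᴴ‖ ≤ ((L : ℝ) ^ (d + 1))⁻¹ * (Real.sqrt ((L : ℝ) ^ (d + 1)) * (1 + ε) ^ D) := mul_le_mul_of_nonneg_left h (inv_nonneg.2 hL0.le)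
    _ = (1 + ε) ^ D / Real.sqrt ((L : ℝ) ^ (d + 1)) := by
        rw [eq_div_iff hs0.ne']
        calc ((L : ℝ) ^ (d + 1))⁻¹ * (Real.sqrt ((L : ℝ) ^ (d + 1)) * (1 + ε) ^ D) * Real.sqrt ((L : ℝ) ^ (d + 1))
            = ((L : ℝ) ^ (d + 1))⁻¹ * (Real.sqrt ((L : ℝ) ^ (d + 1)) * Real.sqrt ((L : ℝ) ^ (d + 1))) * (1 + ε) ^ D := by ring
          _ = (1 + ε) ^ D := by rw [Real.mul_self_sqrt hL0.le, inv_mul_cancel₀ hL0.ne', one_mul]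

/-- ★★★ **THE `η`-POWERS CANCEL IN THE SANDWICH**: for ANY fine operator `S`, `U` within `ε` of `U₀`, `V` within `ε′` of `U₀ᴴ`: `‖Q(U)·S·Q♯_K(V)‖ ≤ (1+ε)^D(1+ε′)^D·‖S‖`.
[cite: King1986, (2.14) p.653, (4.45) p.675; Balaban1985BackgroundPropagators, (3.39) p.397] -/
theorem l2_opNorm_zero_sandwich_le_of_near {U V : Tor (fine L M) × Fin (d + 1) → Matrix n n 𝕜} (hU : ∀ bd, ‖U bd - U₀ bd‖ ≤ ε) {ε' : ℝ} (hε0' : 0 ≤ ε') (hV : ∀ bd, ‖V bd - (U₀ bd)ᴴ‖ ≤ ε')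
    (S : Matrix (Tor (fine L M) × n) (Tor (fine L M) × n) 𝕜) : ‖covQ T M U * S * cxKingQadj T M V‖ ≤ (1 + ε) ^ D * (1 + ε') ^ D * ‖S‖ := by
  have hL0 : (0 : ℝ) < (L : ℝ) ^ (d + 1) := by have : (0 : ℝ) < L := (by exact_mod_cast Nat.pos_of_ne_zero (NeZero.ne L)); positivity
  have hs0 : 0 < Real.sqrt ((L : ℝ) ^ (d + 1)) := Real.sqrt_pos.2 hL0
  have hQ := l2_opNorm_covQ_le_of_near T M hD hU₀ hε0 hU
  have hK := l2_opNorm_cxKingQadj_le_of_near T M hD hU₀ hε0' hV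
  calc ‖covQ T M U * S * cxKingQadj T M V‖ ≤ ‖covQ T M U * S‖ * ‖cxKingQadj T M V‖ := Matrix.l2_opNorm_mul _ _
    _ ≤ (‖covQ T M U‖ * ‖S‖) * ‖cxKingQadj T M V‖ := mul_le_mul_of_nonneg_right (Matrix.l2_opNorm_mul _ _) (norm_nonneg _)
    _ ≤ ((1 + ε) ^ D / Real.sqrt ((L : ℝ) ^ (d + 1)) * ‖S‖) * (Real.sqrt ((L : ℝ) ^ (d + 1)) * (1 + ε') ^ D) := by gcongr
    _ = (1 + ε) ^ D * (1 + ε') ^ D * ‖S‖ := by field_simp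

end BlockMaps

/-! ## §2 At the mass radius: `‖C(U,U⁻¹)‖ ≤ a⁻¹ + 4e∕m²` -/

section Radius

variable (hD : ∀ j, T.depth j ≤ (d + 1) * (L - 1)) {a m2 : ℝ} (ha : 0 < a) (hm : 0 < m2) (hL : 1 ≤ L)
variable {U₀ : Tor (fine L M) × Fin (d + 1) → Matrix n n 𝕜} (hU₀ : ∀ bd, U₀ bd ∈ Matrix.unitaryGroup n 𝕜)
variable {U : Tor (fine L M) × Fin (d + 1) → Matrix n n 𝕜} {ε : ℝ} (hε0 : 0 ≤ ε) (hU : ∀ bd, ‖U bd - U₀ bd‖ ≤ ε) (hrad : (L : ℝ) * ε ≤ sliceRadius m2 a d)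
include hD ha hm hL hU₀ hε0 hU hrad

omit [NeZero L] hD ha hm hU₀ hU in
/-- THE TRANSPORT BUDGET AT THE RADIUS: `(1+ε)^D(1+2ε)^D ≤ (1+2ε)^{2D} ≤ e^{4(d+1)Lε} ≤ e` (comb depth `D = (d+1)(L−1)`, `4(d+1)Lε ≤ 4(d+1)s₀ ≤ 1`). [cite: Balaban1985BackgroundPropagators, Thm 3.4 p.400] -/
theorem transport_budget_at_massRadius : (1 + ε) ^ ((d + 1) * (L - 1)) * (1 + 2 * ε) ^ ((d + 1) * (L - 1)) ≤ Real.exp 1 := by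
  have hL0 : (0 : ℝ) < L := by exact_mod_cast hL
  have hτ := tau_slice_le (d := d) hL (D := (d + 1) * (L - 1)) le_rfl (mul_nonneg hL0.le hε0)
  rw [mul_div_cancel_left₀ ε hL0.ne'] at hτ
  have hx1 : 4 * ((d : ℝ) + 1) * ((L : ℝ) * ε) ≤ 1 := by
    have h := hrad.trans (sliceRadius_le m2 a d).1
    rw [le_div_iff₀ (by positivity)] at h; linarith
  have hτe : (1 + 2 * ε) ^ (2 * ((d + 1) * (L - 1))) ≤ Real.exp 1 := by
    have := Real.exp_le_exp.2 hx1; linarith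
  have h1 : (1 + ε) ^ ((d + 1) * (L - 1)) ≤ (1 + 2 * ε) ^ ((d + 1) * (L - 1)) := pow_le_pow_left₀ (by linarith) (by linarith) _
  calc (1 + ε) ^ ((d + 1) * (L - 1)) * (1 + 2 * ε) ^ ((d + 1) * (L - 1)) ≤ (1 + 2 * ε) ^ ((d + 1) * (L - 1)) * (1 + 2 * ε) ^ ((d + 1) * (L - 1)) :=
        mul_le_mul_of_nonneg_right h1 (pow_nonneg (by linarith) _)
    _ = (1 + 2 * ε) ^ (2 * ((d + 1) * (L - 1))) := by rw [← pow_add]; ring_nf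
    _ ≤ Real.exp 1 := hτe

/-- ★★★★ **THE CONTINUED COVARIANCE MINUS THE NOISE IS BOUNDED BY `4e∕m²` IN OPERATOR NORM**: `‖C(U,U⁻¹) − a⁻¹·1‖ ≤ (4∕m²)·e` at the mass radius around every unitary background.
[cite: King1986, (2.14) p.653, (4.45) p.675; Balaban1985BackgroundPropagators, Thm 3.4 p.400, (3.39) p.397] -/
theorem l2_opNorm_cxBlockCov_sub_noise_at_massRadius_le :
    ‖cxBlockCov T M a ((L : ℝ) ^ 2) m2 U (fun bd => (U bd)⁻¹) - (a⁻¹ : 𝕜) • 1‖ ≤ 4 / m2 * Real.exp 1 := by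
  have hεh : ε ≤ 1 / 2 := by
    have hL1 : (1 : ℝ) ≤ L := by exact_mod_cast hL
    have h := hrad.trans (sliceRadius_le m2 a d).1
    have hd : (4 : ℝ) ≤ 4 * ((d : ℝ) + 1) := by have : (0 : ℝ) ≤ d := Nat.cast_nonneg d; linarith
    have h2 : (L : ℝ) * ε ≤ 1 / 4 := h.trans (one_div_le_one_div_of_le (by norm_num) hd)
    nlinarith
  rw [cxBlockCov_zero_sandwich]
  have hS := l2_opNorm_zero_sandwich_le_of_near T M hD hU₀ hε0 hU (by linarith : (0 : ℝ) ≤ 2 * ε) (slice_near_bwd M hU₀ hU hεh) ((cxFullOp T M 0 ((L : ℝ) ^ 2) m2 U (fun bd => (U bd)⁻¹))⁻¹)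
  have hB := l2_opNorm_cxFullOp_zero_inv_at_massRadius_le T M hD ha hm hL hU₀ hε0 hU hrad
  have hτ := transport_budget_at_massRadius (d := d) hL hε0 hrad
  calc _ ≤ (1 + ε) ^ ((d + 1) * (L - 1)) * (1 + 2 * ε) ^ ((d + 1) * (L - 1)) * ‖(cxFullOp T M 0 ((L : ℝ) ^ 2) m2 U (fun bd => (U bd)⁻¹))⁻¹‖ := hS
    _ ≤ Real.exp 1 * (4 / m2) := mul_le_mul hτ hB (norm_nonneg _) (Real.exp_nonneg _)
    _ = 4 / m2 * Real.exp 1 := mul_comm _ _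

omit hD hm hL hU₀ hε0 hU hrad in
/-- The noise in operator norm: `‖a⁻¹·1‖ ≤ a⁻¹`. [folklore] -/
theorem l2_opNorm_noise_le : ‖(a⁻¹ : 𝕜) • (1 : Matrix (Tor M × n) (Tor M × n) 𝕜)‖ ≤ a⁻¹ := by
  rw [norm_smul, show ((a : 𝕜))⁻¹ = ((a⁻¹ : ℝ) : 𝕜) by push_cast; rfl, RCLike.norm_ofReal, abs_of_nonneg (inv_nonneg.2 ha.le)]
  calc a⁻¹ * ‖(1 : Matrix (Tor M × n) (Tor M × n) 𝕜)‖ ≤ a⁻¹ * 1 := mul_le_mul_of_nonneg_left (by rw [Matrix.cstar_norm_def, map_one]; exact ContinuousLinearMap.norm_id_le) (inv_nonneg.2 ha.le)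
    _ = a⁻¹ := mul_one _

/-- ★★★★ **NE2's UNIT LAYER IS BOUNDED IN OPERATOR NORM THROUGHOUT THE POLYDISC**: `‖C(U,U⁻¹)‖ ≤ a⁻¹ + (4∕m²)e` for every complex `U` with `‖U_b − U₀_b‖ ≤ ε`, `Lε ≤ s₀(m²,a,d)`,
around EVERY unitary background `U₀` — constants `(m²,a)` only, uniform in `L` (the spacing), the volume, the fibre and the contour system. [cite: King1986, (4.34) p.674, (4.45) p.675; Balaban1985BackgroundPropagators, Thm 3.4 p.400] -/
theorem l2_opNorm_cxBlockCov_at_massRadius_le : ‖cxBlockCov T M a ((L : ℝ) ^ 2) m2 U (fun bd => (U bd)⁻¹)‖ ≤ a⁻¹ + 4 / m2 * Real.exp 1 := by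
  have h1 := l2_opNorm_cxBlockCov_sub_noise_at_massRadius_le T M hD ha hm hL hU₀ hε0 hU hrad
  have h2 := l2_opNorm_noise_le (𝕜 := 𝕜) (n := n) M ha
  calc ‖cxBlockCov T M a ((L : ℝ) ^ 2) m2 U (fun bd => (U bd)⁻¹)‖
      = ‖(a⁻¹ : 𝕜) • (1 : Matrix (Tor M × n) (Tor M × n) 𝕜) + (cxBlockCov T M a ((L : ℝ) ^ 2) m2 U (fun bd => (U bd)⁻¹) - (a⁻¹ : 𝕜) • 1)‖ := by rw [add_sub_cancel]
    _ ≤ ‖(a⁻¹ : 𝕜) • (1 : Matrix (Tor M × n) (Tor M × n) 𝕜)‖ + ‖cxBlockCov T M a ((L : ℝ) ^ 2) m2 U (fun bd => (U bd)⁻¹) - (a⁻¹ : 𝕜) • 1‖ := norm_add_le _ _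
    _ ≤ a⁻¹ + 4 / m2 * Real.exp 1 := add_le_add h2 h1

end Radius

/-! ## §3 At a unitary field: `‖(Δ_eff(U))⁻¹‖ ≤ a⁻¹ + m⁻²` in operator norm -/

section Unitary

variable {D : ℕ} (hD : ∀ j, T.depth j ≤ D) {a c m2 : ℝ} (ha : 0 < a) (hc : 0 ≤ c) (hm : 0 < m2)
variable {U : Tor (fine L M) × Fin (d + 1) → Matrix n n 𝕜} (hU : ∀ bd, U bd ∈ Matrix.unitaryGroup n 𝕜)
include hD ha hc hm hU

omit hD ha in
/-- PART Ͱ-f IN OPERATOR NORM: `‖(−cΔ_U + m²)⁻¹‖ ≤ m⁻²` at every unitary `U` (`c ≥ 0`, `m² > 0`). [cite: Balaban1985BackgroundPropagators, (3.39) p.397; King1986, (4.33) p.674] -/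
theorem l2_opNorm_covLapF_inv_le : ‖(covLapF (fine L M) c m2 U)⁻¹‖ ≤ m2⁻¹ :=
  l2_opNorm_le_of_forall_norm_mulVec_le _ (inv_nonneg.2 hm.le) fun w => norm_toLp_inv_mulVec_le (fine L M) hc hm hU (ofLp w)

/-- ★★★ **`‖(Δ_eff(U))⁻¹ − a⁻¹·1‖ ≤ m⁻²` AT EVERY UNITARY BACKGROUND** (`a, m² > 0`, `c ≥ 0`, depth `≤ D`; no window, any curvature): the covariant block average of the covariant fine
covariance has operator norm at most `m⁻²` (`‖Q(U)‖‖Q(U)^*‖ = 1`). [cite: King1986, (2.14) p.653, (4.45) p.675; Balaban1985BackgroundPropagators, (3.25) p.394, (3.39) p.397] -/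
theorem l2_opNorm_effLapU_inv_sub_noise_le : ‖(effLapU T M a c m2 U)⁻¹ - (a⁻¹ : 𝕜) • 1‖ ≤ m2⁻¹ := by
  have h0 : ∀ bd, ‖U bd - U bd‖ ≤ 0 := fun bd => by rw [sub_self, norm_zero]
  have h0' : ∀ bd, ‖(fun bd => (U bd)ᴴ) bd - (U bd)ᴴ‖ ≤ 0 := fun bd => by simp only [sub_self, norm_zero, le_refl]
  rw [← cxBlockCov_adjoint_eq_inv_effLapU T M ha hc hm hU, cxBlockCov_zero_sandwich, cxFullOp_zero_adjoint_eq_covLapF]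
  have hS := l2_opNorm_zero_sandwich_le_of_near T M hD hU le_rfl h0 le_rfl h0' ((covLapF (fine L M) c m2 U)⁻¹)
  rw [add_zero, one_pow, one_mul, one_mul] at hS
  exact hS.trans (l2_opNorm_covLapF_inv_le M hc hm hU)

/-- ★★★ **PART Ϥ-k's SANDWICH IN OPERATOR NORM**: `‖(Δ_eff(U))⁻¹‖ ≤ a⁻¹ + m⁻²` at every unitary background — NE2's unit layer is `O(1)` in operator norm uniformly in the background, the spacing,
the volume and the fibre. [cite: King1986, (2.14) p.653, (4.45) p.675; Balaban1985BackgroundPropagators, (3.39) p.397] -/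
theorem l2_opNorm_effLapU_inv_le : ‖(effLapU T M a c m2 U)⁻¹‖ ≤ a⁻¹ + m2⁻¹ := by
  have h1 := l2_opNorm_effLapU_inv_sub_noise_le T M hD ha hc hm hU
  have h2 := l2_opNorm_noise_le (𝕜 := 𝕜) (n := n) M ha
  calc ‖(effLapU T M a c m2 U)⁻¹‖ = ‖(a⁻¹ : 𝕜) • (1 : Matrix (Tor M × n) (Tor M × n) 𝕜) + ((effLapU T M a c m2 U)⁻¹ - (a⁻¹ : 𝕜) • 1)‖ := by rw [add_sub_cancel]
    _ ≤ ‖(a⁻¹ : 𝕜) • (1 : Matrix (Tor M × n) (Tor M × n) 𝕜)‖ + ‖(effLapU T M a c m2 U)⁻¹ - (a⁻¹ : 𝕜) • 1‖ := norm_add_le _ _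
    _ ≤ a⁻¹ + m2⁻¹ := add_le_add h2 h1

end Unitary

end Summit.QuantumFields.YangMills.BalabanUVNodes.N15KingModelRung.Analytic

end
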